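import Mathlib.GroupTheory.SemidirectProduct
import Mathlib.Data.Finsupp.Basic
import Mathlib.Algebra.BigOperators.Finsupp.Basic
import Mathlib.Algebra.Group.Pi.Lemmas
import Mathlib.Algebra.Group.Subgroup.Lattice
import Mathlib.Logic.Function.Basic
import Mathlib.Order.Basic
import HarnessLib

/-!
# The first Grigorchuk group `𝔊 = ⟨a, b, c, d⟩` acting on the boundary `{0,1}^ℕ` of the binary rooted tree, its level-one stabiliser,
# and Bartholdi–Erschler's permutational wreath products `ℤ^k ≀_X 𝔊` over the orbit `X = 𝔊ρ` of the ray `ρ = 1^∞`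

builds on p205010 (kernel theorem, internal audit signed; external expert review pending) — nothing in this file uses p205010; NOTHING is claimed about any node.
DEFINITIONS (the objects the lane's customers «GrigorchukLamplighterCriticalContinuity» are typed against: published objects reproduced with
citation tags) + their elementary API; no instance, no notation.  Lane `prim-bschramm`, seat `prim-bschramm-p3` gen 34 (design owner;
`run/shared/lean/prim/bschramm/P3-NILPOTENT.md` §27, offer (O2), lead ruling 2026-08-27 22:31Z: 'Transplant defs file per the lane's convention for
posited objects').  Helper file (`--supports stmt-CriticalPhenomena-4575 --as helper`).  NOTHING about the growth,
torsion or amenability of `𝔊` is stated or used anywhere in the lane: those are the CITED facts that make the customers interesting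
(Grigorchuk 1980/1984: `𝔊` is an infinite finitely generated torsion group of intermediate growth; Bartholdi–Erschler 2012: `ℤ^k ≀_X 𝔊` has
growth `exp(n^{α₀} log n)`, `α₀ ≈ 0.7674`).

* §1 `Ray = ℕ → Bool` (infinite rays `x₀ x₁ x₂ …` of the binary tree, `false = 0`, `true = 1`), `flipAt`, the four generators as explicit
  involutions of `Ray`: `genA` flips the first letter; for `x = 1^k 0 y` the generators `b, c, d` act on the letter after the first `0` —
  `genB` flips it iff `k mod 3 ≠ 2`, `genC` iff `k mod 3 ≠ 1`, `genD` iff `k mod 3 ≠ 0` — and fix the ray `ρ = 1^∞` (the closed form of the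
  wreath recursion `a = σ`, `b = (a, c)`, `c = (a, d)`, `d = (1, b)`); `grigorchukGroup = ⟨genA, genB, genC, genD⟩ ≤ Perm(Ray)`;
  `stabOne` = the permutations of `Ray` preserving the first letter (so `stabOne ⊓ 𝔊 = St_𝔊(1)`), with `genB, genC, genD ∈ stabOne ∌ genA`.
* §2 LAMPS: for an additive group `M`, `lampAut M : Perm(Ray) →* MulAut (Multiplicative (Ray →₀ M))` (a permutation transports finitely
  supported configurations, `(g·f)(x) = f(g⁻¹ x)`), the semidirect product `LampGroup M = (Ray →₀ M) ⋊ Perm(Ray)`, the lamp letters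
  `lamp x m` and tree letters `tree g`, and the TOTAL LAMP SUM `lampSum M : LampGroup M →* Multiplicative M` (a homomorphism since transport
  preserves sums).
* §3 THE PERMUTATIONAL WREATH PRODUCTS as subgroups of `LampGroup`: `wreathZ2 = ⟨a, b, c, d, (ρ ↦ e₀), (ρ ↦ e₁)⟩ = ℤ² ≀_X 𝔊` (Bartholdi–Erschler's
  `W` with `A = ℤ²`, standard generating set) and `wreathZ = ⟨a, b, c, d, (ρ ↦ 1)⟩ = ℤ ≀_X 𝔊` (`A = ℤ`, standard generating set `{a, b, c, d, s}`);
  lamps only ever sit on the orbit `X = 𝔊ρ`, so these subgroups ARE the permutational wreath products over `X` (B–E §2: the action of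
  `A ≀_X G` on `X × A` is faithful).  The extra lamp letter `asa = (ρa ↦ 1)` of the lane's lamp-complete generating set is `lamp (genA ρ) 1`.
* §4 THE LANE'S COSET DATA on `Γ₂` (for `P3-NILPOTENT.md` §27.1): the letters `aW … s'W : ↥wreathZ`, the lamp-complete generating set
  `lampCompleteGens = {a, b, c, d, s, asa}`, the index-two subgroup `stabOneW = (⊕ ℤ) ⋊ St(1)` (tree part in `stabOne`), the two level-one lamp sums
  `blockSum : (Ray →₀ ℤ) →+ ℤ²` (invariant under `stabOne`-transport) and the BLOCK CHARACTER `blockChar : stabOneW →* ℤ²`.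
[cite: Grigorchuk1980, definition of the generators a, b, c, d] [cite: BartholdiErschler2012, §2 (permutational wreath products, standard generating
set, Cayley graph), §3.1 (the first Grigorchuk group; ρ = 1^∞ is fixed by b, c, d), §5 (ℤ^k ≀_X 𝔊)]
-/

noncomputable section

namespace Summit.CriticalPhenomena.PercolationContinuityZ3.Theorems.Transplant

namespace Grigorchuk

open scoped Classical

/-! ## §1 The generators on the boundary of the binary tree -/

/-- The boundary of the binary rooted tree: infinite rays `x : ℕ → Bool` (`x n` = the `n`-th letter, `false = 0`, `true = 1`).
[cite: BartholdiErschler2012, §3 (rays, the boundary ∂T)] -/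
abbrev Ray : Type := ℕ → Bool

/-- Flip the `n`-th letter of a ray. [cite: Grigorchuk1980, definition of a] -/
def flipAt (n : ℕ) (x : Ray) : Ray := Function.update x n (!x n)

/-- `flipAt n` changes the `n`-th letter … [folklore] -/
@[simp] theorem flipAt_apply_self (n : ℕ) (x : Ray) : flipAt n x n = !x n := by
  simp [flipAt]

/-- … and no other letter. [folklore] -/
@[simp] theorem flipAt_apply_ne {n m : ℕ} (h : m ≠ n) (x : Ray) : flipAt n x m = x m := by
  simp [flipAt, h]

/-- `flipAt n` is an involution. [folklore] -/
theorem flipAt_involutive (n : ℕ) : Function.Involutive (flipAt n) := fun x => by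
  funext m
  by_cases h : m = n
  · subst h; simp
  · simp [h]

/-- **The root generator `a`**: flips the first letter (the non-trivial permutation of the two level-one subtrees).
[cite: Grigorchuk1980, definition of a] [cite: BartholdiErschler2012, §3.1] -/
def genA : Equiv.Perm Ray := (flipAt_involutive 0).toPerm _

/-- `a x = flipAt 0 x`. [cite: Grigorchuk1980, definition of a] -/
@[simp] theorem genA_apply (x : Ray) : genA x = flipAt 0 x := rfl

/-- The common shape of `b, c, d`: on `x = 1^k 0 y` flip the letter after the first `0` iff the section pattern `P` holds at `k`; fix the
ray `1^∞`.  (Closed form of the wreath recursion along the spine `1^k`.) [cite: Grigorchuk1980, definition of b, c, d]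
[cite: BartholdiErschler2012, §3.1 (wreath recursion)] -/
def sectionGen (P : ℕ → Bool) (x : Ray) : Ray :=
  if h : ∃ k, x k = false then (if P (Nat.find h) then flipAt (Nat.find h + 1) x else x) else x

/-- After a flip strictly beyond the first `0`, the first `0` is where it was. [folklore] -/
theorem find_flipAt_succ {x : Ray} (h : ∃ k, x k = false) (h' : ∃ k, flipAt (Nat.find h + 1) x k = false) :
    Nat.find h' = Nat.find h := by
  rw [Nat.find_eq_iff]
  constructor
  · rw [flipAt_apply_ne (by omega)]
    exact Nat.find_spec h
  · intro n hn
    rw [flipAt_apply_ne (by omega)]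
    exact Nat.find_min h hn

/-- `sectionGen P` is an involution. [folklore] -/
theorem sectionGen_involutive (P : ℕ → Bool) : Function.Involutive (sectionGen P) := fun x => by
  unfold sectionGen
  by_cases h : ∃ k, x k = false
  · rw [dif_pos h]
    by_cases hP : P (Nat.find h) = true
    · rw [if_pos hP]
      have h' : ∃ k, flipAt (Nat.find h + 1) x k = false :=
        ⟨Nat.find h, by rw [flipAt_apply_ne (by omega)]; exact Nat.find_spec h⟩
      rw [dif_pos h', find_flipAt_succ h h', if_pos hP]
      exact flipAt_involutive _ x
    · rw [if_neg hP, dif_pos h, if_neg hP]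
  · rw [dif_neg h, dif_neg h]

/-- **The generator `b`** (`b = (a, c)`): on `1^k 0 y` it flips the first letter of `y` iff `k mod 3 ≠ 2`.
[cite: Grigorchuk1980, definition of b] [cite: BartholdiErschler2012, §3.1] -/
def genB : Equiv.Perm Ray := (sectionGen_involutive fun k => decide (k % 3 ≠ 2)).toPerm _

/-- **The generator `c`** (`c = (a, d)`): on `1^k 0 y` it flips the first letter of `y` iff `k mod 3 ≠ 1`.
[cite: Grigorchuk1980, definition of c] [cite: BartholdiErschler2012, §3.1] -/
def genC : Equiv.Perm Ray := (sectionGen_involutive fun k => decide (k % 3 ≠ 1)).toPerm _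

/-- **The generator `d`** (`d = (1, b)`): on `1^k 0 y` it flips the first letter of `y` iff `k mod 3 ≠ 0`.
[cite: Grigorchuk1980, definition of d] [cite: BartholdiErschler2012, §3.1] -/
def genD : Equiv.Perm Ray := (sectionGen_involutive fun k => decide (k % 3 ≠ 0)).toPerm _

/-- `b x = sectionGen _ x`. [cite: Grigorchuk1980, definition of b] -/
@[simp] theorem genB_apply (x : Ray) : genB x = sectionGen (fun k => decide (k % 3 ≠ 2)) x := rfl
/-- `c x = sectionGen _ x`. [cite: Grigorchuk1980, definition of c] -/
@[simp] theorem genC_apply (x : Ray) : genC x = sectionGen (fun k => decide (k % 3 ≠ 1)) x := rfl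
/-- `d x = sectionGen _ x`. [cite: Grigorchuk1980, definition of d] -/
@[simp] theorem genD_apply (x : Ray) : genD x = sectionGen (fun k => decide (k % 3 ≠ 0)) x := rfl

/-- **THE FIRST GRIGORCHUK GROUP** `𝔊 = ⟨a, b, c, d⟩ ≤ Perm({0,1}^ℕ)`. [cite: Grigorchuk1980, definition of the group]
[cite: BartholdiErschler2012, §3.1] -/
def grigorchukGroup : Subgroup (Equiv.Perm Ray) := Subgroup.closure {genA, genB, genC, genD}

/-- The ray `ρ = 1^∞`. [cite: BartholdiErschler2012, §3.1 (ρ = 1^∞)] -/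
def rho : Ray := fun _ => true

/-- `ρ` has no letter `0`. [folklore] -/
theorem rho_ne_false : ¬ ∃ k, rho k = false := by
  rintro ⟨k, hk⟩; simp [rho] at hk

/-- The section generators fix `ρ = 1^∞`. [cite: BartholdiErschler2012, §3.1 ("this ray is fixed by b, c, d")] -/
theorem sectionGen_rho (P : ℕ → Bool) : sectionGen P rho = rho := by
  unfold sectionGen; rw [dif_neg rho_ne_false]

/-- **`b, c, d` fix `ρ`.** [cite: BartholdiErschler2012, §3.1 ("this ray is fixed by b, c, d")] -/
theorem genB_rho : genB rho = rho := sectionGen_rho (fun k => decide (k % 3 ≠ 2))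
/-- `c ρ = ρ`. [cite: BartholdiErschler2012, §3.1] -/
theorem genC_rho : genC rho = rho := sectionGen_rho (fun k => decide (k % 3 ≠ 1))
/-- `d ρ = ρ`. [cite: BartholdiErschler2012, §3.1] -/
theorem genD_rho : genD rho = rho := sectionGen_rho (fun k => decide (k % 3 ≠ 0))

/-- `a ρ = 0 1^∞ ≠ ρ`: its first letter is `0`. [cite: BartholdiErschler2012, §3.1] -/
theorem genA_rho_zero : genA rho 0 = false := by simp [rho]

/-- The section generators preserve the first letter of every ray. [cite: Grigorchuk1980, definition of b, c, d (they fix the first level)] -/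
theorem sectionGen_apply_zero (P : ℕ → Bool) (x : Ray) : sectionGen P x 0 = x 0 := by
  unfold sectionGen
  by_cases h : ∃ k, x k = false
  · rw [dif_pos h]
    by_cases hP : P (Nat.find h) = true
    · rw [if_pos hP, flipAt_apply_ne (by omega)]
    · rw [if_neg hP]
  · rw [dif_neg h]

/-- `a` flips the first letter of every ray. [cite: Grigorchuk1980, definition of a] -/
theorem genA_apply_zero (x : Ray) : genA x 0 = !x 0 := by simp

/-- **The level-one stabiliser** (in `Perm({0,1}^ℕ)`): the permutations preserving the first letter of every ray; its intersection with `𝔊`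
is `St_𝔊(1) = ⟨b, c, d, aba, aca, ada⟩`. [cite: BartholdiErschler2012, §3 (level stabilisers)] -/
def stabOne : Subgroup (Equiv.Perm Ray) where
  carrier := {g | ∀ x : Ray, g x 0 = x 0}
  mul_mem' {g h} hg hh x := by rw [Equiv.Perm.mul_apply, hg, hh]
  one_mem' x := rfl
  inv_mem' {g} hg x := by
    have h := hg (g⁻¹ x)
    rw [Equiv.Perm.inv_def, Equiv.apply_symm_apply] at h
    rw [Equiv.Perm.inv_def]
    exact h.symm

/-- Membership in `stabOne`. [folklore] -/
theorem mem_stabOne {g : Equiv.Perm Ray} : g ∈ stabOne ↔ ∀ x : Ray, g x 0 = x 0 := Iff.rfl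

/-- `b ∈ St(1)`. [cite: BartholdiErschler2012, §3.1] -/
theorem genB_mem_stabOne : genB ∈ stabOne := fun x => sectionGen_apply_zero (fun k => decide (k % 3 ≠ 2)) x
/-- `c ∈ St(1)`. [cite: BartholdiErschler2012, §3.1] -/
theorem genC_mem_stabOne : genC ∈ stabOne := fun x => sectionGen_apply_zero (fun k => decide (k % 3 ≠ 1)) x
/-- `d ∈ St(1)`. [cite: BartholdiErschler2012, §3.1] -/
theorem genD_mem_stabOne : genD ∈ stabOne := fun x => sectionGen_apply_zero (fun k => decide (k % 3 ≠ 0)) x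

/-- `a ∉ St(1)`. [cite: BartholdiErschler2012, §3.1] -/
theorem genA_not_mem_stabOne : genA ∉ stabOne := fun h => by
  have := h rho
  rw [genA_apply_zero] at this
  simp [rho] at this

/-! ## §2 Lamps: finitely supported configurations transported by permutations, the semidirect product, the total lamp sum -/

section Lamps

variable (M : Type) [AddCommGroup M]

/-- **Transport of lamp configurations** by a permutation of the rays: `(g·f)(x) = f(g⁻¹ x)` (`Finsupp.domCongr`), as a homomorphism
`Perm(Ray) → MulAut` of the (multiplicatively written) configuration group. [cite: BartholdiErschler2012, §2 ((g·f)(x) = f(xg))] -/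
def lampAut : Equiv.Perm Ray →* MulAut (Multiplicative (Ray →₀ M)) where
  toFun g := AddEquiv.toMultiplicative (Finsupp.domCongr g)
  map_one' := by
    refine MulEquiv.ext fun f => ?_
    change Multiplicative.ofAdd (Finsupp.equivMapDomain (1 : Equiv.Perm Ray) (Multiplicative.toAdd f)) = f
    rw [Equiv.Perm.one_def, Finsupp.equivMapDomain_refl]
    rfl
  map_mul' g h := by
    refine MulEquiv.ext fun f => ?_
    change Multiplicative.ofAdd (Finsupp.equivMapDomain (g * h) (Multiplicative.toAdd f)) =
      Multiplicative.ofAdd (Finsupp.equivMapDomain g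
        (Multiplicative.toAdd (Multiplicative.ofAdd (Finsupp.equivMapDomain h (Multiplicative.toAdd f)))))
    rw [Equiv.Perm.mul_def, Finsupp.equivMapDomain_trans]
    rfl

/-- Unfolding `lampAut`. [folklore] -/
theorem toAdd_lampAut_apply (g : Equiv.Perm Ray) (f : Multiplicative (Ray →₀ M)) :
    Multiplicative.toAdd (lampAut M g f) = Finsupp.equivMapDomain g (Multiplicative.toAdd f) := rfl

/-- **The lamp group** `(Ray →₀ M) ⋊ Perm(Ray)` (all finitely supported `M`-configurations on the boundary, acted on by all permutations);
the permutational wreath products live inside it. [cite: BartholdiErschler2012, §2 (W = (Σ_X A) ⋊ G)] -/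
abbrev LampGroup : Type := Multiplicative (Ray →₀ M) ⋊[lampAut M] Equiv.Perm Ray

variable {M}

/-- The lamp letter: add `m` at the ray `x`. [cite: BartholdiErschler2012, §2 (the embedding a ↦ (f_a, 1))] -/
def lamp (x : Ray) (m : M) : LampGroup M := SemidirectProduct.inl (Multiplicative.ofAdd (Finsupp.single x m))

/-- The tree letter: a permutation of the rays. [cite: BartholdiErschler2012, §2 (the embedding g ↦ (1, g))] -/
def tree (g : Equiv.Perm Ray) : LampGroup M := SemidirectProduct.inr g

/-- Components of a lamp letter. [folklore] -/
@[simp] theorem lamp_left (x : Ray) (m : M) : (lamp x m).left = Multiplicative.ofAdd (Finsupp.single x m) := rfl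
/-- Components of a lamp letter. [folklore] -/
@[simp] theorem lamp_right (x : Ray) (m : M) : (lamp x m).right = 1 := rfl
/-- Components of a tree letter. [folklore] -/
@[simp] theorem tree_left (g : Equiv.Perm Ray) : (tree (M := M) g).left = 1 := rfl
/-- Components of a tree letter. [folklore] -/
@[simp] theorem tree_right (g : Equiv.Perm Ray) : (tree (M := M) g).right = g := rfl

/-- **Conjugating a lamp by a tree letter moves it**: `g · (x ↦ m) · g⁻¹ = (g x ↦ m)`. [cite: BartholdiErschler2012, §2 (sup(g·f) = sup(f)g⁻¹)] -/
theorem tree_mul_lamp_mul_tree_inv (g : Equiv.Perm Ray) (x : Ray) (m : M) :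
    tree g * lamp x m * (tree g)⁻¹ = (lamp (g x) m : LampGroup M) := by
  rw [lamp, tree, ← map_inv, ← SemidirectProduct.inl_aut, lamp]
  congr 1
  change Multiplicative.ofAdd (Finsupp.equivMapDomain g (Finsupp.single x m)) = _
  rw [Finsupp.equivMapDomain_single]

variable (M)

/-- **The total lamp sum** `ε(f, g) = Σ_x f(x)` — a homomorphism `LampGroup M → M`: the augmentation `Σ_X A → A` is invariant under transport by
permutations, hence extends to the semidirect product. [folklore] [cite: BartholdiErschler2012, §2 (W = Σ_X A ⋊ G)] -/
def lampSum : LampGroup M →* Multiplicative M where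
  toFun p := Multiplicative.ofAdd ((Multiplicative.toAdd p.left).sum fun _ m => m)
  map_one' := by simp
  map_mul' p q := by
    rw [← ofAdd_add]
    congr 1
    rw [SemidirectProduct.mul_left, toAdd_mul, toAdd_lampAut_apply, Finsupp.sum_add_index', Finsupp.equivMapDomain_eq_mapDomain,
      Finsupp.sum_mapDomain_index]
    · intro; rfl
    · intros; rfl
    · intro; rfl
    · intros; rfl

/-- The lamp sum of a lamp letter is its value. [folklore] -/
@[simp] theorem lampSum_lamp (x : Ray) (m : M) : lampSum M (lamp x m) = Multiplicative.ofAdd m := by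
  simp [lampSum, lamp]

/-- The lamp sum of a tree letter vanishes. [folklore] -/
@[simp] theorem lampSum_tree (g : Equiv.Perm Ray) : lampSum M (tree g) = 1 := by
  simp [lampSum, tree]

end Lamps

/-! ## §3 Bartholdi–Erschler's permutational wreath products over the orbit of `ρ` -/

/-- **`W = ℤ² ≀_X 𝔊`** with its standard generating set: the subgroup of the lamp group generated by the tree letters `a, b, c, d` and the two
lamp letters `(ρ ↦ e₀)`, `(ρ ↦ e₁)` (Bartholdi–Erschler's `W` for `A = ℤ²`; growth `exp(n^{α₀} log n)` by their Lemma 5.1 — CITED, not used).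
[cite: BartholdiErschler2012, §2 (standard generating set S = S_A ∪ S_G), §5 (A = ℤ^k)] -/
def wreathZ2 : Subgroup (LampGroup (Fin 2 → ℤ)) :=
  Subgroup.closure {tree genA, tree genB, tree genC, tree genD, lamp rho (Pi.single 0 1), lamp rho (Pi.single 1 1)}

/-- **`Γ₂ = ℤ ≀_X 𝔊`** with its standard generating set `{a, b, c, d, s}`, `s = (ρ ↦ 1)` (Bartholdi–Erschler's Theorem 5.3 group for `k = 1`;
growth `exp(n^{α₀} log n)` — CITED, not used). [cite: BartholdiErschler2012, §2 (standard generating set), Thm. 5.3] -/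
def wreathZ : Subgroup (LampGroup ℤ) :=
  Subgroup.closure {tree genA, tree genB, tree genC, tree genD, lamp rho 1}

/-- The extra lamp letter `a s a = (ρa ↦ 1)` lies in `Γ₂`. [cite: BartholdiErschler2012, §2 (conjugates of lamp letters)] -/
theorem lamp_genA_rho_mem_wreathZ : (lamp (genA rho) 1 : LampGroup ℤ) ∈ wreathZ := by
  rw [← tree_mul_lamp_mul_tree_inv]
  refine Subgroup.mul_mem _ (Subgroup.mul_mem _ ?_ ?_) (Subgroup.inv_mem _ ?_)
  · exact Subgroup.subset_closure (by simp)
  · exact Subgroup.subset_closure (by simp)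
  · exact Subgroup.subset_closure (by simp)

/-! ## §4 The lane's coset data on `Γ₂ = ℤ ≀_X 𝔊` (for the orbit theorem on the cosets of `(⊕ ℤ) ⋊ St(1)`, `P3-NILPOTENT.md` §27.1) -/

section CosetData

/-- The letter `a` of `Γ₂`. [cite: BartholdiErschler2012, §2 (standard generating set)] -/
def aW : ↥wreathZ := ⟨tree genA, Subgroup.subset_closure (by simp)⟩
/-- The letter `b` of `Γ₂`. [cite: BartholdiErschler2012, §2 (standard generating set)] -/
def bW : ↥wreathZ := ⟨tree genB, Subgroup.subset_closure (by simp)⟩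
/-- The letter `c` of `Γ₂`. [cite: BartholdiErschler2012, §2 (standard generating set)] -/
def cW : ↥wreathZ := ⟨tree genC, Subgroup.subset_closure (by simp)⟩
/-- The letter `d` of `Γ₂`. [cite: BartholdiErschler2012, §2 (standard generating set)] -/
def dW : ↥wreathZ := ⟨tree genD, Subgroup.subset_closure (by simp)⟩
/-- The lamp letter `s = (ρ ↦ 1)` of `Γ₂`. [cite: BartholdiErschler2012, §2 (standard generating set)] -/
def sW : ↥wreathZ := ⟨lamp rho 1, Subgroup.subset_closure (by simp)⟩
/-- The extra lamp letter `asa = (ρa ↦ 1)` of `Γ₂` (lane, `P3-NILPOTENT.md` §27.1). [cite: BartholdiErschler2012, §2 (conjugates of lamp letters)] -/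
def s'W : ↥wreathZ := ⟨lamp (genA rho) 1, lamp_genA_rho_mem_wreathZ⟩

/-- **The LAMP-COMPLETE generating set `S₂ = {a, b, c, d, s, asa}`** of `Γ₂ = ℤ ≀_X 𝔊` (one lamp letter in each level-one subtree; lane,
`P3-NILPOTENT.md` §27.1).  Bartholdi–Erschler's standard generating set is `{a, b, c, d, s}`. [cite: BartholdiErschler2012, §2 (standard generating set)] -/
def lampCompleteGens : Finset ↥wreathZ := {aW, bW, cW, dW, sW, s'W}

/-- **`(⊕ ℤ) ⋊ St(1) ≤ Γ₂`**: the elements of `Γ₂` whose tree part preserves the first letter (index two; the acting group of §27.1).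
[cite: BartholdiErschler2012, §3 (level stabilisers)] -/
def stabOneW : Subgroup ↥wreathZ := stabOne.comap (SemidirectProduct.rightHom.comp wreathZ.subtype)

/-- Membership in `stabOneW`: the tree part preserves the first letter of every ray. [folklore] -/
theorem mem_stabOneW {π : ↥wreathZ} : π ∈ stabOneW ↔ ∀ x : Ray, (π : LampGroup ℤ).right x 0 = x 0 := Iff.rfl

/-- The weight of a ray in the block character: `e₁` if its first letter is `1`, `e₀` if it is `0` (lane construction, `P3-NILPOTENT.md` §27.1). [folklore] -/
def blockWeight (x : Ray) : ℤ →+ (Fin 2 → ℤ) := AddMonoidHom.single (fun _ : Fin 2 => ℤ) (if x 0 then 1 else 0)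

/-- **The two level-one LAMP SUMS** `f ↦ (Σ_{x ∈ 0T} f x, Σ_{x ∈ 1T} f x) ∈ ℤ²` (block sums over the two level-one subtrees; lane construction,
`P3-NILPOTENT.md` §27.1). [folklore] -/
def blockSum : (Ray →₀ ℤ) →+ (Fin 2 → ℤ) := Finsupp.liftAddHom blockWeight

/-- `blockSum` of a single lamp. [folklore] -/
theorem blockSum_single (x : Ray) (m : ℤ) : blockSum (Finsupp.single x m) = Pi.single (if x 0 then (1 : Fin 2) else 0) m := by
  rw [blockSum, Finsupp.liftAddHom_apply_single, blockWeight, AddMonoidHom.single_apply]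

/-- **The block sums are invariant under transport by a permutation preserving first letters.** [folklore] -/
theorem blockSum_equivMapDomain {g : Equiv.Perm Ray} (hg : g ∈ stabOne) (f : Ray →₀ ℤ) :
    blockSum (Finsupp.equivMapDomain g f) = blockSum f := by
  rw [blockSum, Finsupp.liftAddHom_apply, Finsupp.liftAddHom_apply, Finsupp.equivMapDomain_eq_mapDomain,
    Finsupp.sum_mapDomain_index_addMonoidHom]
  refine Finsupp.sum_congr fun x _ => ?_
  rw [blockWeight, blockWeight, mem_stabOne.1 hg x]

/-- **THE BLOCK CHARACTER `c : (⊕ ℤ) ⋊ St(1) → ℤ²`**, `c(f, η) = (Σ_{0T} f, Σ_{1T} f)` — a homomorphism because `η ∈ St(1)` preserves the two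
level-one subtrees (the rank-two character of `P3-NILPOTENT.md` §27.1 — lane construction; `c(asa) = e₀`, `c(s) = e₁`). [folklore]
[cite: BartholdiErschler2012, §3.1 (St(1) preserves the first level)] -/
def blockChar : ↥stabOneW →* Multiplicative (Fin 2 → ℤ) where
  toFun π := Multiplicative.ofAdd (blockSum (Multiplicative.toAdd ((π : ↥wreathZ) : LampGroup ℤ).left))
  map_one' := by simp
  map_mul' π₁ π₂ := by
    rw [← ofAdd_add]
    congr 1
    have e : (((π₁ * π₂ : ↥stabOneW) : ↥wreathZ) : LampGroup ℤ) = ((π₁ : ↥wreathZ) : LampGroup ℤ) * ((π₂ : ↥wreathZ) : LampGroup ℤ) := rfl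
    rw [e, SemidirectProduct.mul_left, toAdd_mul, map_add, toAdd_lampAut_apply, blockSum_equivMapDomain (mem_stabOneW.1 π₁.2)]

/-- Unfolding `blockChar`. [folklore] -/
theorem toAdd_blockChar (π : ↥stabOneW) :
    Multiplicative.toAdd (blockChar π) = blockSum (Multiplicative.toAdd ((π : ↥wreathZ) : LampGroup ℤ).left) := rfl

end CosetData

end Grigorchuk

end Summit.CriticalPhenomena.PercolationContinuityZ3.Theorems.Transplant

end
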